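import Literature.MathematicalPhysics.QuantumFieldTheory.Balaban1983to89.Node00.MultiScaleFibreChartTwist
import Literature.MathematicalPhysics.QuantumFieldTheory.Balaban1983to89.B16Ineq19FlatSliceChart
import Literature.MathematicalPhysics.QuantumFieldTheory.Balaban1983to89.BlockAveragingSectionQsstar
import Literature.MathematicalPhysics.QuantumFieldTheory.Balaban1983to89.T3DescentFibreTower

/-!
# [Balaban1989LargeFieldII] (1.7) AT A NEAR-FLAT BACKGROUND — THE DATA ALONG PRINT'S SLICE FAMILY ARE LEFT TRANSLATES AT EVERY SCALE:
# `M˙(Q_k^{s*}(e^{iB′}·Ṽ_k))_j(c) = e^{i B′(c̄)}·M˙(Q_k^{s*}Ṽ_k)_j(c)` (or `= M˙(Q_k^{s*}Ṽ_k)_j(c)`), hence the family-on-fibre letter (F) of the chart of record and the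
# skeleton's affine-datum binder `haff` follow from the minimiser-family letter (K′) ALONE

statement-level skeleton of published theorems with citation tags; proofs where landed; nothing here is a claim about the Yang–Mills mass gap

Cell `pub-ymgap`, HUMAN RULING D-0062 ∕ D-0149, WIDTH SEAT `pub-ymgap-dag-n12-w4` g2 (node N12 = [B15]; U2c lane = the VALUE-level near-flat assembly of [B16] (1.7); key K1⁷
`stmt-QuantumFields-20542`, `--kind proof --supports …`; count-neutral).

WHY THIS FILE.  `Node00.MultiScaleFibreChartTwist` (p606233) discharges the near-flat skeleton's binder `haff` (and identifies the datum velocity `y` of the Federbush fibre letter)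
in the chart of record `msChart F N K k 𝐁 W U₀` from ONE displayed letter: along the family, every constrained average is a left translate `e^{Z(g)_{(j,c)}}·W_j(c)` of the datum
with `Z` linear (`havg`).  At the N12 record the datum of print's slice family is `W(Y) = M˙(Q_k^{s*}(exp(i·ιA Y)·Ṽ_k))` ([Balaban1989LargeFieldI] (1.74) p. 192, (1.77) p. 194,
[Balaban1989LargeFieldII] p. 359) and the family of minimisers lies on its fibres (the (K′) letter, dag-n12-c's shape: `∀ᶠ Y, IsMinimizer … (M˙(Q_k^{s*}(exp(i·ιA Y)·Ṽ_k)))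
(expChart U₀ (X_f Y))`).  This file proves that `havg` FOLLOWS, with no placement hypothesis on the shells `Γ_j`, `j < k`: the scale-`j` entry of `M˙(Q_k^{s*}V)` is the
pull-back `Q^{s*}_{k−j}V` (the section identity `M^j Q^{s*}_j = id` of [BalabanImbrieJaffe1985] (2.19), tree `BlockAveragingSectionQsstar.iter_blockAvg_qsstarGIter0`), and the
pull-back `Q^{s*}` ([BalabanImbrieJaffe1985] (4.5.3): `1` inside a block, `V(b̄)` on a corridor bond) COMMUTES with bondwise left multiplication up to a linear relabelling of the
Lie field — `Q^{s*}(e^{A}·V)(b) = e^{Ã(b)}·Q^{s*}V(b)`, `Ã(b) = A(b̄)` on corridor bonds and `0` inside blocks (`e^0 = 1`).  Iterating, at EVERY constrained bond `(j,c)`, shells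
included, `W(Y)_j(c) = e^{i·ιA Y(c̄)}·W_j(c)` or `= W_j(c)` — a left translate by a Lie element LINEAR in `Y`.  With dag-n12-w3's dictionary `expPoint v = expSU (φ v)`
(`B16Ineq19FlatSliceChart.expPoint_eq_expSU`) this is p606233's `havg` verbatim, so `haff` and the twisted datum velocity (β3) hold at the record from (K′) alone.

CONTENTS (namespace `…B16Ineq17NearFlatDatumFamily`).
* §1 (any gauge group `G`, any `ExpChart G 𝔤`, any small-loop average `ℰ` with `ℰ(1,…,1) = 1`): `qsstarG_expMul` (one step), ★★ `exists_pullLie` (`k`-fold, all scales `j ≤ k`: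
  `∃ ℓ : (j : ℕ) → PBond P j → (VecField P k 𝔤 →ₗ[ℝ] 𝔤)`, `ℓ k c = proj c`, each `ℓ j c = 0 ∨ ∃ c̄, ℓ j c = proj c̄`, and
  `M^j(Q_k^{s*}(expMul χ A V))(c) = χ.iexp (ℓ j c A) · M^j(Q_k^{s*}V)(c)`).
* §2 (SU(2), `su2Chart`, the slice `GaugeSlice S T ℝ³`): ★★★ `exists_twistFamily_of_isMinimizer_family` — from (K′) (`hmin`, eventual near `0`) a continuous linear
  `Zf : GaugeSlice S T ℝ³ →L[ℝ] (ConstrSet 𝐁 k → 𝔰𝔲(2))` with `Zf Y (k,c) = φ(ιA Y c)`, each component `0` or `φ(ιA Y c̄)`, and p606233's `havg`.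
* §3 ★★★ `haff_msChart_of_isMinimizer_family` (the skeleton's `haff` at `Ψ := msChart F 2 K k 𝐁 (M˙(Q_k^{s*}Ṽ_k)) U₀` from `hmin` alone),
  ★★ `fderiv_msChart_comp_apply_top_of_isMinimizer_family` ((β3): `DΨ(X_f 0)(X_f′ h)` at the top-level constrained bond `(k,c)` is `Ad_{W_k(c)⁻¹} φ(ιA h c)`).

Nothing of Bałaban's is asserted; count-neutral; N12 NOT discharged; the YM mass gap (Clay) is NOT proved by any of this.
-/

noncomputable section

namespace Literature.MathematicalPhysics.QuantumFieldTheory.Balaban1983to89.B16Ineq17NearFlatDatumFamily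

open Filter Topology
open T4Continuum BlockAveraging B16Sect1Backgrounds B15DeterminingSets GaugeField
open Literature.MathematicalPhysics.QuantumFieldTheory.BalabanImbrieJaffe1984to88.BIJ85Eq453GaugeField
  (qsstarG qsstarGIter0 qsstarG_apply qsstarGIter0_succ qsstarGIter0_zero)

/-! ## §1  The pull-back `Q^{s*}` commutes with bondwise left multiplication up to a linear relabelling of the Lie field -/

section PullBack

variable {P : Params} {G : Type*} [GaugeGroup G] {𝔤 : Type*} [AddCommGroup 𝔤] [Module ℝ 𝔤]

/-- **ONE STEP**: `Q^{s*}(e^{A}·V)(b) = e^{Ã(b)}·Q^{s*}V(b)` with `Ã(b) = A(b̄)` (`b̄ = ⟨B(b₋), dir b⟩`) on a corridor bond and `Ã(b) = 0` inside a block (`χ.iexp 0 = 1`).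
[cite: BalabanImbrieJaffe1985, (4.5.3) p.312; Balaban1989LargeFieldII, (1.16) p.360, p.359] -/
theorem qsstarG_expMul (ch : ExpChart G 𝔤) {k : ℕ} (A : VecField P (k + 1) 𝔤) (V : GaugeField P (k + 1) G) :
    qsstarG (expMul ch A V) = expMul ch (fun b => if blockOf b.tgt = blockOf b.src then 0 else A ⟨blockOf b.src, b.dir⟩) (qsstarG V) := by
  funext b
  simp only [qsstarG_apply, expMul]
  split_ifs with h
  · rw [ch.iexp_zero, one_mul]
  · rfl


/-- ★★ **THE DATA OF A LEFT-TRANSLATED CONFIGURATION ARE LEFT TRANSLATES AT EVERY SCALE**: for `k ≤ m + K`, a small-loop average `ℰ` fixing constant families and any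
exponential chart `χ`, there are linear functionals `ℓ_{(j,c)}` on the scale-`k` Lie fields — `ℓ_{(k,c)} = ev_c`, and each `ℓ_{(j,c)}` either `0` or an evaluation `ev_{c̄}` — with
`M^j(Q_k^{s*}(expMul χ A V))(c) = χ.iexp(ℓ_{(j,c)} A) · M^j(Q_k^{s*}V)(c)` for all `j ≤ k` (induction on `k`: the top scale by the section identity `M^k Q_k^{s*} = id`
(`BlockAveragingSectionQsstar.iter_blockAvg_qsstarGIter0`), the lower scales through `Q^{s*}_{k+1} = Q^{s*}_k ∘ Q^{s*}` and `qsstarG_expMul`).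
[cite: BalabanImbrieJaffe1985, (2.19) p.305, (4.5.3) p.312; Balaban1988Convergent, (2.16) p.257, p.267; Balaban1989LargeFieldI, (1.74) p.192] -/
theorem exists_pullLie (ch : ExpChart G 𝔤) (ℰ : LoopAverage G) (hE : ∀ n : ℕ, ℰ.E (fun _ : Fin (n + 1) => (1 : G)) = 1) :
    ∀ (k : ℕ), k ≤ P.m + P.K →
      ∃ ℓ : (j : ℕ) → PBond P j → (VecField P k 𝔤 →ₗ[ℝ] 𝔤),
        (∀ c : PBond P k, ℓ k c = LinearMap.proj c) ∧
        (∀ (j : ℕ) (c : PBond P j), ℓ j c = 0 ∨ ∃ c' : PBond P k, ℓ j c = LinearMap.proj c') ∧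
        ∀ (A : VecField P k 𝔤) (V : GaugeField P k G) (j : ℕ), j ≤ k → ∀ c : PBond P j,
          Averaging.iter (fun i => blockAvg (P := P) (j := i) ℰ) j (qsstarGIter0 k (expMul ch A V)) c
            = ch.iexp (ℓ j c A) * Averaging.iter (fun i => blockAvg (P := P) (j := i) ℰ) j (qsstarGIter0 k V) c
  | 0, _ => by
    refine ⟨fun j => match j with
      | 0 => fun c => LinearMap.proj c
      | _ + 1 => fun _ => 0, fun c => rfl, ?_, ?_⟩
    · intro j c
      cases j with
      | zero => exact Or.inr ⟨c, rfl⟩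
      | succ j => exact Or.inl rfl
    · intro A V j hj c
      obtain rfl : j = 0 := Nat.le_zero.mp hj
      rfl
  | k + 1, hk => by
    obtain ⟨ℓ, hℓtop, hℓshape, hℓ⟩ := exists_pullLie ch ℰ hE k (Nat.le_of_succ_le hk)
    -- the one-step Lie pull-back `A ↦ (b ↦ 0 inside a block, A(b̄) on a corridor bond)`
    let qL : VecField P (k + 1) 𝔤 →ₗ[ℝ] VecField P k 𝔤 :=
      { toFun := fun A b => if blockOf b.tgt = blockOf b.src then 0 else A ⟨blockOf b.src, b.dir⟩
        map_add' := fun A B => by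
          funext b
          simp only [Pi.add_apply]
          split_ifs <;> simp
        map_smul' := fun r A => by
          funext b
          simp only [Pi.smul_apply, RingHom.id_apply]
          split_ifs <;> simp }
    have hqL : ∀ (A : VecField P (k + 1) 𝔤) (b : PBond P k), qL A b = if blockOf b.tgt = blockOf b.src then 0 else A ⟨blockOf b.src, b.dir⟩ :=
      fun A b => rfl
    have hstep : ∀ (A : VecField P (k + 1) 𝔤) (V : GaugeField P (k + 1) G), qsstarG (expMul ch A V) = expMul ch (qL A) (qsstarG V) := by
      intro A V
      funext b
      simp only [qsstarG_apply, expMul, hqL]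
      split_ifs with h
      · rw [ch.iexp_zero, one_mul]
      · rfl
    let ℓ' : (j : ℕ) → PBond P j → (VecField P (k + 1) 𝔤 →ₗ[ℝ] 𝔤) := fun j c =>
      if h : j = k + 1 then LinearMap.proj (cast (congrArg (PBond P) h) c) else (ℓ j c).comp qL
    have hdef : ∀ (j : ℕ) (c : PBond P j),
        ℓ' j c = if h : j = k + 1 then LinearMap.proj (cast (congrArg (PBond P) h) c) else (ℓ j c).comp qL := fun _ _ => rfl
    refine ⟨ℓ', ?_, ?_, ?_⟩
    · intro c
      rw [hdef, dif_pos rfl]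
      rfl
    · intro j c
      by_cases h : j = k + 1
      · subst h
        refine Or.inr ⟨c, ?_⟩
        rw [hdef, dif_pos rfl]
        rfl
      · rw [hdef, dif_neg h]
        rcases hℓshape j c with h0 | ⟨c', hc'⟩
        · left
          rw [h0, LinearMap.zero_comp]
        · rw [hc']
          by_cases hb : blockOf c'.tgt = blockOf c'.src
          · left
            apply LinearMap.ext
            intro A
            show qL A c' = 0
            rw [hqL, if_pos hb]
          · right
            refine ⟨⟨blockOf c'.src, c'.dir⟩, ?_⟩
            apply LinearMap.ext
            intro A
            show qL A c' = A ⟨blockOf c'.src, c'.dir⟩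
            rw [hqL, if_neg hb]
    · intro A V j hj c
      by_cases h : j = k + 1
      · subst h
        rw [BlockAveragingSectionQsstar.iter_blockAvg_qsstarGIter0 ℰ hE (k + 1) hk,
          BlockAveragingSectionQsstar.iter_blockAvg_qsstarGIter0 ℰ hE (k + 1) hk, hdef, dif_pos rfl]
        rfl
      · have hj' : j ≤ k := by omega
        rw [hdef, dif_neg h, qsstarGIter0_succ, qsstarGIter0_succ, hstep, hℓ (qL A) (qsstarG V) j hj' c]
        rfl

end PullBack

/-! ## §2  At the record: the twisted Lie family of print's slice family, from the minimiser-family letter (K′) -/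

section Record

open T4CubeChartGnomonic (SU2)
open B15Prop1ChartSU2 (su2Chart su2Chart_iexp)
open B15Prop1SliceCoordinates (GaugeSlice ιA)
open T4HaarSU2ExpChart (imQuat expPoint)
open T4AdjointCovarianceUnitary (lieSU expSU specialUnitaryAd)
open Literature.MathematicalPhysics.QuantumLattice (quatMatrix)
open Node00 (SU expChart msChart ConstrSet constrCard constrEnum avOfRecord)
open ExpMeanLog (expMeanLogSU)
open B16Ineq19FlatSliceChart (expPoint_eq_expSU)

variable {F : T4Family} {K k : ℕ} (S : Set (Site (F.P K) k)) (T : Finset (PBond (F.P K) k))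
variable {φ : EuclideanSpace ℝ (Fin 3) →ₗ[ℝ] lieSU (Fin 2)}

/-- ★★★ **THE FAMILY-ON-FIBRE LETTER (F) FROM THE MINIMISER-FAMILY LETTER (K′)** — no placement hypothesis.  If near `Y = 0` the configuration `expChart U₀ (X_f Y)` is a
minimal configuration for the datum `M˙(Q_k^{s*}(exp(i·ιA Y)·V))` on `𝐁` (dag-n12-c's (K′) shape; `𝐁`, `reg`, `V`, `U₀`, `X_f` arbitrary; `k ≤ m + K`), then there is a continuous
linear `Zf : B′ ↦ (Z(B′)_{(j,c)})_{(j,c) ∈ 𝐁}` into `𝔰𝔲(2)`-families — `Z(B′)_{(k,c)} = φ(ιA B′ c)` at the top scale, every component `0` or `φ(ιA B′ c̄)` — such that near `0`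
every constrained average of the family is the left translate `Ū^j(expChart U₀ (X_f Y))(c) = expSU(Z(Y)_{(j,c)})·M˙(Q_k^{s*}V)_j(c)`: the hypothesis `havg` of
`Node00.MultiScaleFibreChartTwist` (p606233) verbatim (`g₀ = 0`).  (`φ` = dag-n12-w3's `ℝ³ → 𝔰𝔲(2)` dictionary, `B16Ineq19FlatSliceChart.expPoint_eq_expSU`; `ιA` is made
continuous by the explicit bound `‖ιA B′ b‖ ≤ ‖B′‖`, `B15Prop1SliceCoordinates.norm_ιA_apply_le`.)
[cite: Balaban1989LargeFieldI, (1.74) p.192, (1.77) and Prop. 1 p.194; Balaban1989LargeFieldII, p.359, (1.19) p.360; Balaban1988Convergent, (2.12) p.256, (2.16) p.257] -/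
theorem exists_twistFamily_of_isMinimizer_family (hk : k ≤ (F.P K).m + (F.P K).K)
    (hφ : ∀ v, ((φ v : lieSU (Fin 2)) : Matrix (Fin 2) (Fin 2) ℂ) = quatMatrix (imQuat v))
    (𝔹 : DetSet (F.P K)) (reg : Set (GaugeField (F.P K) 0 (SU 2))) (V : GaugeField (F.P K) k (SU 2)) (U₀ : GaugeField (F.P K) 0 (SU 2))
    {Xf : GaugeSlice S T (EuclideanSpace ℝ (Fin 3)) → PBond (F.P K) 0 → lieSU (Fin 2)}
    (hmin : ∀ᶠ Y in 𝓝 (0 : GaugeSlice S T (EuclideanSpace ℝ (Fin 3))),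
      IsMinimizer (avOfRecord F 2 K) reg 𝔹 (avgFamily (avOfRecord F 2 K) (qsstarGIter0 k (expMul su2Chart (ιA S T Y) V))) (expChart U₀ (Xf Y))) :
    ∃ Zf : GaugeSlice S T (EuclideanSpace ℝ (Fin 3)) →L[ℝ] (ConstrSet 𝔹 k → lieSU (Fin 2)),
      (∀ Y (c : PBond (F.P K) k) (hc : c ∈ bondsOf (𝔹 k)), Zf Y ⟨Fin.last k, c, hc⟩ = φ (ιA S T Y c)) ∧
      (∀ s : ConstrSet 𝔹 k, (∀ Y, Zf Y s = 0) ∨ ∃ c' : PBond (F.P K) k, ∀ Y, Zf Y s = φ (ιA S T Y c')) ∧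
      ∀ᶠ Y in 𝓝 (0 : GaugeSlice S T (EuclideanSpace ℝ (Fin 3))), ∀ s : ConstrSet 𝔹 k,
        avgFamily (avOfRecord F 2 K) (expChart U₀ (Xf Y)) s.1 s.2.1
          = expSU (Zf (Y - 0) s) * avgFamily (avOfRecord F 2 K) (qsstarGIter0 k V) s.1 s.2.1 := by
  obtain ⟨ℓ, hℓtop, hℓshape, hℓ⟩ := exists_pullLie (P := F.P K) su2Chart (expMeanLogSU (n := Fin 2))
    (fun n => T3DescentFibreTower.expMeanLogSU_E_one (N := Fin 2) n) k hk
  -- `ιA` as a continuous linear map by an explicit bound (the `PiLp` slice wants `mkContinuous`, not `toContinuousLinearMap`)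
  let ιAL : GaugeSlice S T (EuclideanSpace ℝ (Fin 3)) →L[ℝ] VecField (F.P K) k (EuclideanSpace ℝ (Fin 3)) :=
    (ιA S T).mkContinuous 1 fun B => by
      rw [one_mul]
      exact (pi_norm_le_iff_of_nonneg (norm_nonneg B)).2 fun b => B15Prop1SliceCoordinates.norm_ιA_apply_le B b
  let Zf : GaugeSlice S T (EuclideanSpace ℝ (Fin 3)) →L[ℝ] (ConstrSet 𝔹 k → lieSU (Fin 2)) :=
    ContinuousLinearMap.pi fun s : ConstrSet 𝔹 k => (LinearMap.toContinuousLinearMap (φ ∘ₗ ℓ (s.1 : ℕ) s.2.1)).comp ιAL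
  have hZf : ∀ Y s, Zf Y s = φ (ℓ (s.1 : ℕ) s.2.1 (ιA S T Y)) := fun _ _ => rfl
  refine ⟨Zf, ?_, ?_, ?_⟩
  · intro Y c hc
    rw [hZf]
    show φ (ℓ k c (ιA S T Y)) = _
    rw [hℓtop]
    rfl
  · intro s
    rcases hℓshape (s.1 : ℕ) s.2.1 with h0 | ⟨c', hc'⟩
    · left
      intro Y
      rw [hZf, h0, LinearMap.zero_apply, map_zero]
    · right
      refine ⟨c', fun Y => ?_⟩
      rw [hZf, hc']
      rfl
  · filter_upwards [hmin] with Y hY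
    intro s
    have hj : (s.1 : ℕ) ≤ k := Nat.lt_succ_iff.mp s.1.isLt
    rw [sub_zero, hY.2.1 (s.1 : ℕ) s.2.1 s.2.2]
    show Averaging.iter (fun i : ℕ => (blockAvg expMeanLogSU : Averaging (F.P K) i (SU 2))) (s.1 : ℕ)
        (qsstarGIter0 k (expMul su2Chart (ιA S T Y) V)) s.2.1
      = expSU (Zf Y s) * Averaging.iter (fun i : ℕ => (blockAvg expMeanLogSU : Averaging (F.P K) i (SU 2))) (s.1 : ℕ) (qsstarGIter0 k V) s.2.1
    rw [hℓ (ιA S T Y) V (s.1 : ℕ) hj s.2.1, hZf, su2Chart_iexp, expPoint_eq_expSU hφ]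


/-- ★★★ **THE SKELETON'S `haff` AT THE RECORD FROM (K′) ALONE**: under the minimiser-family letter, for EVERY functional `λ₀` and all directions,
`λ₀ (D²(msChart F 2 K k 𝐁 (M˙(Q_k^{s*}V)) U₀ ∘ X_f)(0)[h,h′]) = 0` — the binder `haff` of `B16Ineq17NearFlatWilsonLetters.hessian_wilsonAction4_criticalExpChartFamily_ge_flatMin_sub` ∕
`B15Prop1SliceHessianOfChartFamily.h17Shape_sliceFn_of_nearFlatCriticalExpChartFamily` at the chart of record (`Node00.haff_msChart_of_avg_family` ∘ §2).
[cite: Balaban1989LargeFieldII, (1.7) p.358, (1.12)–(1.13) p.359; Balaban1985Variational, Sect. C (47)–(48) p.285, (82)–(83) p.290] -/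
theorem haff_msChart_of_isMinimizer_family (hk : k ≤ (F.P K).m + (F.P K).K)
    (hφ : ∀ v, ((φ v : lieSU (Fin 2)) : Matrix (Fin 2) (Fin 2) ℂ) = quatMatrix (imQuat v))
    (𝔹 : DetSet (F.P K)) (reg : Set (GaugeField (F.P K) 0 (SU 2))) (V : GaugeField (F.P K) k (SU 2)) (U₀ : GaugeField (F.P K) 0 (SU 2))
    {Xf : GaugeSlice S T (EuclideanSpace ℝ (Fin 3)) → PBond (F.P K) 0 → lieSU (Fin 2)}
    (hmin : ∀ᶠ Y in 𝓝 (0 : GaugeSlice S T (EuclideanSpace ℝ (Fin 3))),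
      IsMinimizer (avOfRecord F 2 K) reg 𝔹 (avgFamily (avOfRecord F 2 K) (qsstarGIter0 k (expMul su2Chart (ιA S T Y) V))) (expChart U₀ (Xf Y)))
    (lam : (Fin (constrCard 𝔹 k) → lieSU (Fin 2)) →L[ℝ] ℝ) (h h' : GaugeSlice S T (EuclideanSpace ℝ (Fin 3))) :
    lam (fderiv ℝ (fun g => fderiv ℝ (fun g => msChart F 2 K k 𝔹 (avgFamily (avOfRecord F 2 K) (qsstarGIter0 k V)) U₀ (Xf g)) g) 0 h h') = 0 := by
  obtain ⟨Zf, -, -, havg⟩ := exists_twistFamily_of_isMinimizer_family S T hk hφ 𝔹 reg V U₀ hmin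
  exact Node00.haff_msChart_of_avg_family Zf havg lam h h'

/-- ★★ **(β3) THE TWISTED DATUM VELOCITY AT THE RECORD**: under (K′), with `X_f` differentiable at `0` (derivative `X_f′`) and the chart differentiable at `X_f 0`, the top-scale
component of `D(msChart …)(X_f 0)(X_f′ h)` at the constrained bond `(k,c)` is `Ad_{W_k(c)⁻¹} φ(ιA h c)`, `W = M˙(Q_k^{s*}V)` — the `y` of the Federbush fibre letter `hm`∕`hy`, twisted
as located (R2) (`Node00.fderiv_msChart_comp_apply_eq_ad` ∘ §2). [cite: Balaban1989LargeFieldII, (1.12) p.359, (1.19) p.360; Balaban1985Variational, (82)–(83) p.290] -/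
theorem fderiv_msChart_comp_apply_top_of_isMinimizer_family (hk : k ≤ (F.P K).m + (F.P K).K)
    (hφ : ∀ v, ((φ v : lieSU (Fin 2)) : Matrix (Fin 2) (Fin 2) ℂ) = quatMatrix (imQuat v))
    (𝔹 : DetSet (F.P K)) (reg : Set (GaugeField (F.P K) 0 (SU 2))) (V : GaugeField (F.P K) k (SU 2)) (U₀ : GaugeField (F.P K) 0 (SU 2))
    {Xf : GaugeSlice S T (EuclideanSpace ℝ (Fin 3)) → PBond (F.P K) 0 → lieSU (Fin 2)}
    (hmin : ∀ᶠ Y in 𝓝 (0 : GaugeSlice S T (EuclideanSpace ℝ (Fin 3))),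
      IsMinimizer (avOfRecord F 2 K) reg 𝔹 (avgFamily (avOfRecord F 2 K) (qsstarGIter0 k (expMul su2Chart (ιA S T Y) V))) (expChart U₀ (Xf Y)))
    {X' : GaugeSlice S T (EuclideanSpace ℝ (Fin 3)) →L[ℝ] PBond (F.P K) 0 → lieSU (Fin 2)} (hX : HasFDerivAt Xf X' 0)
    (hΨ : DifferentiableAt ℝ (msChart F 2 K k 𝔹 (avgFamily (avOfRecord F 2 K) (qsstarGIter0 k V)) U₀) (Xf 0))
    (h : GaugeSlice S T (EuclideanSpace ℝ (Fin 3))) (c : PBond (F.P K) k) (hc : c ∈ bondsOf (𝔹 k)) :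
    fderiv ℝ (msChart F 2 K k 𝔹 (avgFamily (avOfRecord F 2 K) (qsstarGIter0 k V)) U₀) (Xf 0) (X' h) (constrEnum 𝔹 k ⟨Fin.last k, c, hc⟩)
      = specialUnitaryAd (avgFamily (avOfRecord F 2 K) (qsstarGIter0 k V) k c)⁻¹ (φ (ιA S T h c)) := by
  obtain ⟨Zf, htop, -, havg⟩ := exists_twistFamily_of_isMinimizer_family S T hk hφ 𝔹 reg V U₀ hmin
  rw [Node00.fderiv_msChart_comp_apply_eq_ad Zf havg hX hΨ h]
  have hgen : ∀ x : ConstrSet 𝔹 k, x = ⟨Fin.last k, c, hc⟩ →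
      specialUnitaryAd (avgFamily (avOfRecord F 2 K) (qsstarGIter0 k V) x.1 x.2.1)⁻¹ (Zf h x)
        = specialUnitaryAd (avgFamily (avOfRecord F 2 K) (qsstarGIter0 k V) k c)⁻¹ (φ (ιA S T h c)) := by
    rintro x rfl
    rw [htop]
    rfl
  exact hgen _ ((constrEnum 𝔹 k).symm_apply_apply _)

end Record

end Literature.MathematicalPhysics.QuantumFieldTheory.Balaban1983to89.B16Ineq17NearFlatDatumFamily

end
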